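import Summits.Ventures.AbcSig.Rows.XTemplateC2a
import Summits.Ventures.AbcSig.Levels.N458
import Summits.Ventures.AbcSig.Levels.N1832
import Summits.Ventures.AbcSig.Levels.N458M6X

/-!
# Venture AbcSig — ROW `C2aL229A45`: `xⁿ + 2^a·229^m·yⁿ = z²`, class `a 45` (GENERATED by plean/leanrow.py)

HONEST FRAMING. A row of a COMPUTATION cell (`pub-abcsig`); a CONDITIONAL theorem, no claim on ABC or any summit.
Hypotheses: `BS04Package` (CITED), `DataComplete` at levels [458, 1832] (COMPUTED, two-engine certified
level files), `EisPackage` (CITED: [BS04 (3.1), L4.2, Cor 3.1] + [Sturm 1987]) and `Refines` (COMPUTED) for the orbits whose residual exponent is discharged IN THE KERNEL by a module-M6 certificate (`Levels/N…M6X.lean`), and the listed per-orbit exclusions `hX_…` (CITED; the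
row's R5 cell names each) that remain. Everything else is kernel-checked (`Rows/XTemplateC2a.lean`, `Levels/N….lean`). Exponent
range: prime `n ≥ 11`, `n ≠ 229`; `B = 2^a 229^m` with `a, m < n` (n-th-power free).
Row of record:  (sha256 ; SIGNED 2026-08-22T10:05:22Z by referee (ref-g5)); its R0: THEOREM (uses CITED arithmetic facts) for all primes n >= 11 with n coprime to 3664 — class: candidate (a in {4,5} cell; lit/COVERAGE §C2 + IK06 Thm 1.1 applica. Exponents left open by the row of record are excluded here via ; kernel-sieve residuals the row of record closes by a cell module (M6 Eisenstein / M4 Kraus certificates) appear as CITED hypotheses .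
-/

namespace Summit.Ventures.AbcSig

/-- Row `C2aL229A45` (see module docstring). -/
theorem xrow_C2aL229A45 (M : NewformModel) (hP : M.BS04Package) (hE : M.EisPackage)
    (hD458 : M.DataComplete 458 level458Orbits) (hD1832 : M.DataComplete 1832 level1832Orbits)
    (hR_orbit_458_5 : M.Refines 458 orbit_458_5 m6X_458_5)
    (n : ℕ) (hn : n.Prime) (hmin : 11 ≤ n) (hnℓ : n ≠ 229) (a m : ℕ) (ha : a = 4 ∨ a = 5) (hm : 1 ≤ m) (han : a < n) (hmn : m < n)
    
    (x y z : ℤ) (hxy1 : x * y ≠ 1) (hxy2 : x * y ≠ -1) : ¬ IsPrimitiveSolution 1 (2 ^ a * 229 ^ m) 1 n x y z := by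
  have hℓ : Nat.Prime 229 := by norm_num
  have h7 : 7 ≤ n := by omega
  have hS458 :=
    (level458_sieve n hn h7 (fun o => M.Excludes 458 o (famB (2 ^ a * 229 ^ m) n (fun _ _ => True)) ∨ M.ExcludesStd 458 o n) (fun hmem => by
      obtain rfl : n = 7 := by simpa using hmem
      omega) (fun hmem => by
      obtain rfl : n = 7 := by simpa using hmem
      omega) (fun hmem => by
      rcases (by simpa using hmem : n = 7 ∨ n = 23) with rfl | rfl
      · omega
      · exact Or.inr (m6c_458_5_n23_excludes M hE hR_orbit_458_5)))
  have hS1832 :=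
    (level1832_sieve n hn h7 (fun o => M.Excludes 1832 o (famB (2 ^ a * 229 ^ m) n (fun _ _ => True)) ∨ M.ExcludesStd 1832 o n) (fun hmem => by
      obtain rfl : n = 7 := by simpa using hmem
      omega) (fun hmem => by
      obtain rfl : n = 7 := by simpa using hmem
      omega))
  exact xrowC2a_a45 229 hℓ (by norm_num) M hP n hn h7 hnℓ hD1832 hD458 a m ha hm han hmn
    hS1832
    hS458 x y z hxy1 hxy2

end Summit.Ventures.AbcSig
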